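import Mathlib
import Literature.MathematicalPhysics.QuantumFieldTheory.Balaban1983to89.B6Lemma21TwoScale

/-!
# `Balaban1983to89.B6Lemma21Bridge` — the geometric bridge (2.54)–(2.58) of B6 Lemma 2.1 KERNEL-CHECKED down to the
typed decomposition data (2.47)/(2.48)/(2.57), with a THIRD located defect of the count (2.58): the scaled-image
chains do not determine the surface-index sequence (multiplicity up to `2^{m−1}`), absorbed by the SAME (2.59) with
the constant `c₁″ = 13c₀(½α)^{4d}` UNCHANGED

CITATION HEADER (lean-in-tree rule 2026-08-18). Source: T. Bałaban, *Propagators and renormalization transformations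
for lattice gauge theories. II*, Comm. Math. Phys. **96**, 223–250 (1984) [Balaban1984PropagatorsII] (cell paper B6;
PDF `paper:balaban1984-cmp96-propagators-rt-ii`, journal page = PDF page + 222; every quotation below read from the
renders `b2b-balaban-ref1/pages/1984-cmp96-propagators-rt-II/…-p009/p010/p011/p012-x2.png` = pp. 231–234).
Adversarial reader 1, gen 11 (GAPS G-A16-1, C-A16-1; continuation of the gen 5–8 chain G-A10-1/G-A11-1/G-A12-1/
G-A13-1). This module is a reproduction/audit of a PUBLISHED proof step; nothing here is a claim about the summit.

THE STEP UNDER AUDIT (pp. 231–233). The proof of Lemma 2.1 decomposes the minimising admissible contour as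
(2.47) p. 231: *"Γ_{y,y′} = Γ_{y,y₁} ∪ ⋃_{l=1}^m (Γ_{y_l,y′_l} ∪ Γ_{y′_l,y_{l+1}}), y_{m+1} = y′, … y_l, y′_l ∈ Σ_{j_l},
Γ_{y_l,y′_l} does not intersect any other surface Σ_j, j ≠ j_l, Γ_{y′_l,y_{l+1}} connects the surface Σ_{j_l} with the
surface Σ_{j_{l+1}} and is contained in B^{j_{l,l+1}}(Λ_{j_{l,l+1}}), where j_{l,l+1} = min{j_l, j_{l+1}},
|j_l − j_{l+1}| = 1."*, obtains (2.48) and (2.57) *"(L^{j_{l,l+1}}η)^{−1}|y′_l − y_{l+1}| > RM"*, and then p. 233: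
*"The distances on the right-hand side of (2.48) are scaled to unit lattice and we estimate e^{−αδ₀d(y,y′)} using
(2.48) and adding sums over all intermediate points y_l, y′_l, l = 1, …, m, and over all possible numbers m"*, with
the count (2.58) = free ℤ^d sums over the scaled images `z₁, z′₁, …, z′_m, z_{m+1}` (*"where s(y) denotes a scaled
image of y on unit lattice"*), one `c₀(½α)^d` per variable.

THE THIRD LOCATED DEFECT (G-A16-1; after G-A11-1 = spurious factor at l = m, and G-A13-1 = two-scale surface legs).
The free sums over the scaled images cannot reproduce the sum over the intermediate points unless the points are
recoverable from the summation variables. They are not: the scale at which the crossing leg Γ_{y′_l,y_{l+1}} is read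
is `j_{l,l+1} = min{j_l, j_{l+1}}` and `j_{l+1} = j_l ± 1` is NOT a function of the scaled images — for the same
coded displacement `v ≠ 0` the two branches land at the DISTINCT points `y′_l + L^{j_l}η·v` (up, `j_{l+1} = j_l + 1`)
and `y′_l + L^{j_l−1}η·v` (down, `j_{l+1} = j_l − 1`) (`branch_positions_distinct`). Reconstruction of the chain
from `(j′, m, z-chain)` therefore has up to `2^{m−1}` preimages (the sign of each of the m − 1 middle surface steps;
`j₁` and the last scale are recovered from the position of `y₁`, the surfaces being disjoint, and from `j′`).
Engine `engines-g11/engine_branched.py` counts the admissible index sequences for fixed `(j, j′, m)`: e.g. 4 for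
`j = j′ = 2, m = 3`, up to 140 in the scanned range — the printed count charges 1. This defect is
READING-INDEPENDENT of the G-ref1-18 dispute over G-A13-1 (whether Σ_j = Λ_j∩Σ_j makes the intermediate points
coarse sites): under EITHER reading the scale at which a crossing leg is read is `min{j_l, j_{l+1}}` with the
branch `j_{l+1} = j_l ± 1` undetermined by the scaled images, so the reconstruction fiber is the same; under the
coarse reading the exponent `d(3m+1)` merely drops to `d(2m+1)` (take the fine codes 0), a fortiori within the
bound proved here. REPAIR (kernel, this module): a
branch bit per middle crossing leg, factor `2^{(m−1)⁺}`; under the SAME (2.59) the geometric ratio becomes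
`q′ = 2e^{−A}c³ ≤ 2e^{−2}c^{−1} ≤ 2e^{−2} < e^{−1}` (`2 < e`), so the inner-sum bound and the constant
`c₁″ = 13c₀(½α)^{4d}` of `B6Lemma21TwoScale` survive VERBATIM (`inner_sum_branched_le`, `ineq258Branched_summable_and_le`).

WHAT IS KERNEL-CHECKED (no `sorry`).
1. PER-LEG BRIDGE, the injectivity leaf of (2.58)/(2.58″) DISSOLVED (`Step`, `pathC`, `pathF`, `pathV`,
   `path_l1_bound`, `twoScale_row_sum_of_paths`, `singleScale_row_sum_of_paths`): a leg is a finite list of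
   admissible bonds (unit moves on the coarse or the fine lattice of its surface, each weighing exactly 1 in (2.46)
   — *"|Γ| = nη, where n is a number of bonds"*, p. 231); the signed coarse/fine step counts `(pathC, pathF)` code
   the endpoint with `|pathC|₁ + |pathF|₁ ≤ (number of bonds)`, and the coding of a family of DISTINCT endpoints is
   injective automatically, because `L^{j_l}η·c + L^{j_l−1}η·f` recovers the position — the hypothesis pair of
   `B6Lemma21TwoScale.twoScale_row_sum` holds for ANY family of witnessing legs, and the two-scale
   row sum `c₀(½α)^{2d}` (resp. single-scale `c₀(½α)^d`) needs no separately asserted injectivity. (The coding must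
   be taken from the legs: the canonical block-offset coding `D = Lc + f, f ∈ [0,L)^d` does NOT satisfy the weight
   hypothesis — a one-bond leg to `D = −1` has floor coding `(−1, L−1)` of ℓ¹-size L at L = 4,
   `floorCoding_weight_fails`.)
2. CORRECTED PER-CROSSING-LEG COUNT `2c₀^d` (`branched_row_sum`): endpoint on one of TWO surfaces with different
   scalings, coded by (branch bit, vector).
3. CHAIN THEOREM (`chain_group_sum`): for the group of sites `y′` with a common `(j′, m)` and chain data of the
   printed shape — total bond count ≤ d(y,y′) ((2.46)/(2.48)), RM(m−1)⁺ ≤ d(y,y′) ((2.57) for the m − 1 middle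
   crossing legs, the G-A11-1 repair), codes + branch bits jointly injective — the row sum is
   ≤ e^{−½αδ₀RM(m−1)⁺}·(card B)·c₀(½α)^{d(3m+1)}, by ONE application of the counting lemma per branch pattern.
4. m-FLOOR (`abs_walk_le`, `mFloor`): `|j_l − j_{l+1}| ≤ 1`, `|j₁ − j| ≤ 1`, `|j_m − j′| ≤ 1` force
   `m ≥ max{|j−j′|−1, 0}` — the printed lower limit of the m-sum in (2.58), not argued in print.
5. BRANCHED ARITHMETIC (`inner_sum_branched_le`, `summable_branched_inner`, `ineq258Branched_summable_and_le`):
   with the `2^{(m−1)⁺}` multiplicity the double sum of (2.58″) is still ≤ `c1TwoScale = 13c₀(½α)^{4d}` under the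
   SAME (2.59). Engine 2: `engines-g11/engine_branched.py` (q′-sweep, inner/outer sums, outer constant
   12.751 ≤ 13, index-sequence counts; all PASS).
6. ASSEMBLY (`Decomp247`, `ineq261T_of_decomp`, `lemma21TwoScale_of_decomp`): from typed decomposition data
   (2.47)/(2.48)/(2.57) for every pair (the fields of `Decomp247`, each a direct transcription of a printed
   sentence), the row-sum bound (2.61″) `Ineq261With (c1TwoScale d δ₀ α)` follows — the leaf `h261T` of
   `B6Lemma21TwoScale.lemma21TwoScale_of_ineq261T` is DISCHARGED down to the decomposition data.
WHAT REMAINS (the shrunken leaf, honest): the EXISTENCE of the decomposition data for the minimising contours of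
(2.46) — i.e. that a minimising admissible contour decomposes as (2.47) with the stated properties (first/last
surface intersections, legs between consecutive surfaces, (2.57) from condition (2.2)) and that codes + branch signs
reconstruct the endpoint (disjointness of the surfaces Σ_j). These are the printed sentences of pp. 231–233 quoted
above, typed as the fields of `Decomp247`; no analytic content remains in the bridge. NOTHING of the series is
asserted; value = kernel certificate + located defect, NOT summit progress.
-/

namespace Literature.MathematicalPhysics.QuantumFieldTheory.Balaban1983to89.B6Lemma21Bridge

open B6Lemma21TwoScale (l1)

/-! ## 1. Legs as lists of admissible bonds; the per-leg coding and its ℓ¹ bound -/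

/-- One admissible bond of a leg lying on the surface `Σ_{j_l}`: a unit move in direction `dir`, on the coarse
(`fine = false`, bonds of `Λ_{j_l}`, length `L^{j_l}η`) or the fine (`fine = true`, bonds of `Λ_{j_l−1}`, length
`L^{j_l−1}η`) lattice, forward or backward (p. 231 ll. 20–27: the leg alternates between `B^{j_l}(Λ_{j_l})` and
`B^{j_l−1}(Λ_{j_l−1})`; every admissible bond weighs exactly 1 in (2.46): *"|Γ| = nη, where n is a number of bonds"*).
[cite: Balaban1984PropagatorsII, (2.46)–(2.47) p.231] -/
structure Step (d : ℕ) where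
  dir : Fin d
  fine : Bool
  neg : Bool
deriving DecidableEq

/-- The signed unit of a step. [folklore] -/
def Step.sign {d : ℕ} (s : Step d) : ℤ := if s.neg then -1 else 1

/-- Coarse displacement contribution of one step (coarse-lattice units). [folklore] -/
def Step.cvec {d : ℕ} (s : Step d) : Fin d → ℤ :=
  fun i => if s.fine = false ∧ i = s.dir then s.sign else 0

/-- Fine displacement contribution of one step (fine-lattice units). [folklore] -/
def Step.fvec {d : ℕ} (s : Step d) : Fin d → ℤ :=
  fun i => if s.fine = true ∧ i = s.dir then s.sign else 0

/-- Signed coarse step count of a leg, per coordinate. [folklore] -/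
def pathC {d : ℕ} : List (Step d) → (Fin d → ℤ)
  | [] => 0
  | s :: p => s.cvec + pathC p

/-- Signed fine step count of a leg, per coordinate. [folklore] -/
def pathF {d : ℕ} : List (Step d) → (Fin d → ℤ)
  | [] => 0
  | s :: p => s.fvec + pathF p

/-- Scale-blind displacement (for single-scale legs, where all bonds are bonds of ONE lattice). [folklore] -/
def pathV {d : ℕ} (p : List (Step d)) : Fin d → ℤ := pathC p + pathF p

/-- ℓ¹ is subadditive. [folklore] -/
theorem l1_add_le {ι : Type*} [Fintype ι] (p q : ι → ℤ) : l1 (p + q) ≤ l1 p + l1 q := by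
  unfold B6Lemma21TwoScale.l1
  rw [← Finset.sum_add_distrib]
  refine Finset.sum_le_sum fun i _ => ?_
  exact Int.natAbs_add_le _ _

/-- ℓ¹ of the zero vector. [folklore] -/
theorem l1_zero {ι : Type*} [Fintype ι] : l1 (0 : ι → ℤ) = 0 := by
  unfold B6Lemma21TwoScale.l1
  simp

/-- One step moves one coordinate of one of the two counts by one: `|cvec|₁ + |fvec|₁ ≤ 1`. [folklore] -/
theorem l1_cvec_add_fvec {d : ℕ} (s : Step d) : l1 s.cvec + l1 s.fvec ≤ 1 := by
  have habs : s.sign.natAbs = 1 := by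
    unfold Step.sign
    cases s.neg <;> simp
  unfold B6Lemma21TwoScale.l1 Step.cvec Step.fvec
  have hc : (∑ i, (if s.fine = false ∧ i = s.dir then s.sign else 0).natAbs)
      = if s.fine = false then 1 else 0 := by
    rw [Finset.sum_eq_single s.dir]
    · cases s.fine <;> simp [habs]
    · intro b _ hb
      simp [hb]
    · intro hmem
      exact absurd (Finset.mem_univ s.dir) hmem
  have hfv : (∑ i, (if s.fine = true ∧ i = s.dir then s.sign else 0).natAbs)
      = if s.fine = true then 1 else 0 := by
    rw [Finset.sum_eq_single s.dir]
    · cases s.fine <;> simp [habs]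
    · intro b _ hb
      simp [hb]
    · intro hmem
      exact absurd (Finset.mem_univ s.dir) hmem
  rw [hc, hfv]
  cases s.fine <;> simp

/-- **Per-leg bridge**: the coded displacement of a leg is ℓ¹-dominated by its number of bonds — the weight
hypothesis of the counting lemma holds for the path coding, leg by leg. [cite: Balaban1984PropagatorsII, (2.46)
p.231 («|Γ| = nη, where n is a number of bonds») + p.231 ll.20–27; the bridge step left unproved in print] -/
theorem path_l1_bound {d : ℕ} (p : List (Step d)) : l1 (pathC p) + l1 (pathF p) ≤ p.length := by
  induction p with
  | nil => simp [pathC, pathF, l1_zero]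
  | cons s p ih =>
      have h1 := l1_add_le s.cvec (pathC p)
      have h2 := l1_add_le s.fvec (pathF p)
      have h3 := l1_cvec_add_fvec s
      simp only [pathC, pathF, List.length_cons]
      omega

/-- Single-scale form of the per-leg bridge. [folklore] -/
theorem path_l1_bound_V {d : ℕ} (p : List (Step d)) : l1 (pathV p) ≤ p.length :=
  le_trans (l1_add_le _ _) (path_l1_bound p)

/-- The REMARK behind the defect: the same coded displacement `v ≠ 0` read at two adjacent scales lands at two
DISTINCT points (`L ≥ 2`); the scaled-image chain of (2.58) does not determine the branch. [cite:
Balaban1984PropagatorsII, (2.47) p.231 («j_{l,l+1} = min{j_l, j_{l+1}}, |j_l − j_{l+1}| = 1») + (2.58) p.233] -/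
theorem branch_positions_distinct {d : ℕ} (L : ℤ) (hL : L ≠ 1) (v : Fin d → ℤ) (hv : v ≠ 0) :
    L • v ≠ v := by
  intro h
  apply hv
  funext i
  have hi : L * v i = v i := by
    have h' := congrFun h i
    simpa [Pi.smul_apply, smul_eq_mul] using h'
  have h2 : (L - 1) * v i = 0 := by linear_combination hi
  rcases mul_eq_zero.1 h2 with h1 | h1
  · exact absurd (by omega : L = 1) hL
  · simpa using h1

/-- The canonical block-offset coding (`D = L·c + r`, `r ∈ [0, L)`) does NOT satisfy the weight hypothesis: at
`L = 4` the displacement `D = −1` is reached by ONE fine bond, but its floor coding `(−1, 3)` has ℓ¹-size 4 — the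
coding of the counting lemma must be taken from the legs themselves (§1), not from the endpoint. [folklore] -/
theorem floorCoding_weight_fails :
    ∃ (D L cq r : ℤ), 1 ≤ L ∧ D = L * cq + r ∧ 0 ≤ r ∧ r < L ∧ cq.natAbs + r.natAbs = 4 ∧
      ∃ p : List (Step 1), (L • pathC p + pathF p) = (fun _ => D) ∧ p.length = 1 := by
  refine ⟨-1, 4, -1, 3, by norm_num, by norm_num, by norm_num, by norm_num, by decide,
    [⟨0, true, true⟩], ?_, rfl⟩
  funext i
  have hi : i = (0 : Fin 1) := Fin.eq_zero i
  subst hi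
  simp [pathC, pathF, Step.cvec, Step.fvec, Step.sign]

/-! ## 2. Row sums from witnessing legs: the injectivity leaf dissolved -/

/-- **Two-scale row sum from witnessing legs** (surface legs `y_l → y′_l`). If the endpoints are distinct lattice
positions (`pos` injective) and each is reached by a leg of at most `w x` bonds whose coded displacement recovers
its position, then the hypotheses of `B6Lemma21TwoScale.twoScale_row_sum` hold — the coding `(pathC, pathF)` is
injective BECAUSE `L·c + f` recovers the position — and the row sum is ≤ `c₀^{2d}`. No injectivity of any coding
needs to be asserted separately: this dissolves the `hinj`/`hpath` leaf of G-A13-1. [cite: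
Balaban1984PropagatorsII, (2.58) p.233; corrected] -/
theorem twoScale_row_sum_of_paths {X : Type*} [DecidableEq X] {δ₀ α : ℝ} (h : 0 < α * δ₀) {d : ℕ}
    (L : ℤ) (S : Finset X) (pos : X → (Fin d → ℤ)) (hpos : Set.InjOn pos S)
    (path : X → List (Step d))
    (hdisp : ∀ x ∈ S, pos x = L • pathC (path x) + pathF (path x))
    (w : X → ℝ) (hw : ∀ x ∈ S, ((path x).length : ℝ) ≤ w x) :
    ∑ x ∈ S, Real.exp (-(α * δ₀ * w x)) ≤ B6.c0 δ₀ α ^ (2 * d) := by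
  apply B6Lemma21TwoScale.twoScale_row_sum h S (fun x => pathC (path x)) (fun x => pathF (path x))
  · intro x hx y hy hxy
    simp only [Prod.mk.injEq] at hxy
    apply hpos hx hy
    rw [hdisp x hx, hdisp y hy, hxy.1, hxy.2]
  · intro x hx
    calc ((l1 (pathC (path x)) : ℝ) + l1 (pathF (path x)))
        ≤ ((path x).length : ℝ) := by exact_mod_cast path_l1_bound (path x)
      _ ≤ w x := hw x hx

/-- Single-scale row sum from witnessing legs (the leg `y → y₁` and the crossing legs, each inside one
`B^j(Λ_j)`). [cite: Balaban1984PropagatorsII, (2.47) p.231, (2.58) p.233] -/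
theorem singleScale_row_sum_of_paths {X : Type*} [DecidableEq X] {δ₀ α : ℝ} (h : 0 < α * δ₀) {d : ℕ}
    (S : Finset X) (pos : X → (Fin d → ℤ)) (hpos : Set.InjOn pos S)
    (path : X → List (Step d)) (hdisp : ∀ x ∈ S, pos x = pathV (path x))
    (w : X → ℝ) (hw : ∀ x ∈ S, ((path x).length : ℝ) ≤ w x) :
    ∑ x ∈ S, Real.exp (-(α * δ₀ * w x)) ≤ B6.c0 δ₀ α ^ d := by
  apply B6Lemma21TwoScale.singleScale_row_sum h S (fun x => pathV (path x))
  · intro x hx y hy hxy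
    apply hpos hx hy
    rw [hdisp x hx, hdisp y hy]
    exact hxy
  · intro x hx
    calc ((l1 (pathV (path x)) : ℝ))
        ≤ ((path x).length : ℝ) := by exact_mod_cast path_l1_bound_V (path x)
      _ ≤ w x := hw x hx

/-- **Corrected per-middle-crossing-leg count `2c₀^d`** (G-A16-1): the endpoint `y_{l+1}` lies on one of the TWO
surfaces `Σ_{j_l±1}`, read at DIFFERENT scales `j_{l,l+1} = min{j_l, j_{l+1}}`; coded by (branch bit, vector), the
row sum is ≤ `2c₀^d` — the printed count charges `c₀^d`. [cite: Balaban1984PropagatorsII, (2.47) p.231 + (2.58)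
p.233; corrected] -/
theorem branched_row_sum {X : Type*} [DecidableEq X] {δ₀ α : ℝ} (h : 0 < α * δ₀) {d : ℕ}
    (S : Finset X) (bit : X → Bool) (ρ : X → (Fin d → ℤ))
    (hinj : Set.InjOn (fun x => (bit x, ρ x)) S)
    (w : X → ℝ) (hw : ∀ x ∈ S, (l1 (ρ x) : ℝ) ≤ w x) :
    ∑ x ∈ S, Real.exp (-(α * δ₀ * w x)) ≤ 2 * B6.c0 δ₀ α ^ d := by
  classical
  have hsplit : S = (S.filter fun x => bit x = false) ∪ (S.filter fun x => bit x = true) := by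
    ext x
    simp only [Finset.mem_union, Finset.mem_filter]
    constructor
    · intro hx
      cases hb : bit x
      · exact Or.inl ⟨hx, rfl⟩
      · exact Or.inr ⟨hx, rfl⟩
    · rintro (⟨hx, _⟩ | ⟨hx, _⟩) <;> exact hx
  have hdisj : Disjoint (S.filter fun x => bit x = false) (S.filter fun x => bit x = true) := by
    rw [Finset.disjoint_left]
    intro x hx1 hx2
    have hb1 := (Finset.mem_filter.1 hx1).2
    have hb2 := (Finset.mem_filter.1 hx2).2
    simp [hb1] at hb2
  have hfiber : ∀ b : Bool, ∑ x ∈ S.filter (fun x => bit x = b), Real.exp (-(α * δ₀ * w x))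
      ≤ B6.c0 δ₀ α ^ d := by
    intro b
    apply B6Lemma21TwoScale.singleScale_row_sum h _ ρ
    · intro x hx y hy hxy
      have hbx := (Finset.mem_filter.1 hx).2
      have hby := (Finset.mem_filter.1 hy).2
      apply hinj (Finset.mem_filter.1 hx).1 (Finset.mem_filter.1 hy).1
      simp only [Prod.mk.injEq]
      exact ⟨hbx.trans hby.symm, hxy⟩
    · intro x hx
      exact hw x (Finset.mem_filter.1 hx).1
  calc ∑ x ∈ S, Real.exp (-(α * δ₀ * w x))
      = ∑ x ∈ (S.filter fun x => bit x = false), Real.exp (-(α * δ₀ * w x))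
        + ∑ x ∈ (S.filter fun x => bit x = true), Real.exp (-(α * δ₀ * w x)) := by
        rw [← Finset.sum_union hdisj, ← hsplit]
    _ ≤ B6.c0 δ₀ α ^ d + B6.c0 δ₀ α ^ d := add_le_add (hfiber false) (hfiber true)
    _ = 2 * B6.c0 δ₀ α ^ d := by ring

/-! ## 3. The chain theorem: one (j′, m) group of (2.58) -/

/-- The combined code of a chain: initial-leg vector, per-surface-leg coarse/fine vectors, per-crossing-leg
vector. [folklore] -/
def chainCode {X : Type*} {d m : ℕ} (z0 : X → (Fin d → ℤ)) (cs fs vs : X → Fin m → (Fin d → ℤ))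
    (x : X) : (Fin d ⊕ ((Fin m × (Fin d ⊕ Fin d)) ⊕ (Fin m × Fin d))) → ℤ :=
  Sum.elim (z0 x)
    (Sum.elim (fun p => Sum.elim (cs x p.1) (fs x p.1) p.2) (fun p => vs x p.1 p.2))

/-- The total code weight of a chain. [folklore] -/
def chainWeight {X : Type*} {d m : ℕ} (z0 : X → (Fin d → ℤ)) (cs fs vs : X → Fin m → (Fin d → ℤ))
    (x : X) : ℕ :=
  l1 (z0 x) + (∑ l, (l1 (cs x l) + l1 (fs x l))) + ∑ l, l1 (vs x l)

/-- ℓ¹ of the combined code = total code weight. [folklore] -/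
theorem l1_chainCode {X : Type*} {d m : ℕ} (z0 : X → (Fin d → ℤ))
    (cs fs vs : X → Fin m → (Fin d → ℤ)) (x : X) :
    l1 (chainCode z0 cs fs vs x) = chainWeight z0 cs fs vs x := by
  unfold chainCode chainWeight B6Lemma21TwoScale.l1
  simp only [Fintype.sum_sum_type, Fintype.sum_prod_type, Sum.elim_inl, Sum.elim_inr]
  omega

/-- **Chain theorem.** The group of sites `y′` sharing `(j′, m)`: chain data = one single-scale initial leg, m
two-scale surface legs, m single-scale crossing legs, a branch pattern in a finite type `B` (instantiated with the
`2^{(m−1)⁺}` sign patterns of the middle surface steps), with (2.48) (total code weight ≤ d(y,y′)), (2.57) for the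
m − 1 middle crossing legs (RM(m−1)⁺ ≤ d(y,y′)), and codes + branches jointly injective (sequential reconstruction
of the intermediate points, the surfaces being disjoint). Row sum ≤ e^{−½αδ₀RM(m−1)⁺}·(card B)·c₀(½α)^{d(3m+1)}.
[cite: Balaban1984PropagatorsII, (2.47)–(2.48) pp.231–232, (2.57)–(2.58) p.233; corrected] -/
theorem chain_group_sum {X : Type*} [DecidableEq X] {δ₀ α RM : ℝ} (h : 0 < α * δ₀)
    {d m : ℕ} (S : Finset X) (B : Type*) [Fintype B] [DecidableEq B] (bits : X → B)
    (z0 : X → (Fin d → ℤ)) (cs fs vs : X → Fin m → (Fin d → ℤ))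
    (hinj : Set.InjOn (fun x => (bits x, z0 x, cs x, fs x, vs x)) S)
    (dist : X → ℝ)
    (hsep : ∀ x ∈ S, RM * ((m - 1 : ℕ) : ℝ) ≤ dist x)
    (hwt : ∀ x ∈ S, ((chainWeight z0 cs fs vs x : ℕ) : ℝ) ≤ dist x) :
    ∑ x ∈ S, Real.exp (-(α * δ₀ * dist x)) ≤
      Real.exp (-((1 / 2) * α * δ₀ * (RM * ((m - 1 : ℕ) : ℝ)))) * (Fintype.card B : ℝ) *
        B6.c0 δ₀ (α / 2) ^ (d * (3 * m + 1)) := by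
  classical
  have hh : 0 < (α / 2) * δ₀ := by
    have he : (α / 2) * δ₀ = (α * δ₀) / 2 := by ring
    rw [he]
    exact half_pos h
  have key : ∀ x ∈ S, Real.exp (-(α * δ₀ * dist x)) ≤
      Real.exp (-((1 / 2) * α * δ₀ * (RM * ((m - 1 : ℕ) : ℝ)))) *
        Real.exp (-((α / 2) * δ₀ * ((chainWeight z0 cs fs vs x : ℕ) : ℝ))) := by
    intro x hx
    rw [← Real.exp_add]
    apply Real.exp_le_exp.2
    have h1 := hsep x hx
    have h2 := hwt x hx
    have hpos : (0 : ℝ) ≤ (1 / 2) * (α * δ₀) := by linarith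
    have e1 : (1 / 2) * (α * δ₀) * (RM * ((m - 1 : ℕ) : ℝ)) ≤ (1 / 2) * (α * δ₀) * dist x :=
      mul_le_mul_of_nonneg_left h1 hpos
    have e2 : (1 / 2) * (α * δ₀) * ((chainWeight z0 cs fs vs x : ℕ) : ℝ)
        ≤ (1 / 2) * (α * δ₀) * dist x :=
      mul_le_mul_of_nonneg_left h2 hpos
    nlinarith [e1, e2]
  have hcard : Fintype.card (Fin d ⊕ ((Fin m × (Fin d ⊕ Fin d)) ⊕ (Fin m × Fin d)))
      = d * (3 * m + 1) := by
    simp only [Fintype.card_sum, Fintype.card_prod, Fintype.card_fin]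
    ring
  have hfiber : ∀ b : B, ∑ x ∈ S.filter (fun x => bits x = b),
      Real.exp (-((α / 2) * δ₀ * ((chainWeight z0 cs fs vs x : ℕ) : ℝ)))
        ≤ B6.c0 δ₀ (α / 2) ^ (d * (3 * m + 1)) := by
    intro b
    have hinj' : Set.InjOn (chainCode z0 cs fs vs) ↑(S.filter (fun x => bits x = b)) := by
      intro x hx y hy hxy
      have hbx : bits x = b := (Finset.mem_filter.1 hx).2
      have hby : bits y = b := (Finset.mem_filter.1 hy).2
      apply hinj (Finset.mem_filter.1 hx).1 (Finset.mem_filter.1 hy).1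
      simp only [Prod.mk.injEq]
      refine ⟨hbx.trans hby.symm, ?_, ?_, ?_, ?_⟩
      · funext i
        exact congrFun hxy (Sum.inl i)
      · funext l i
        exact congrFun hxy (Sum.inr (Sum.inl (l, Sum.inl i)))
      · funext l i
        exact congrFun hxy (Sum.inr (Sum.inl (l, Sum.inr i)))
      · funext l i
        exact congrFun hxy (Sum.inr (Sum.inr (l, i)))
    have hres := B6Lemma21TwoScale.sum_exp_le_c0_pow hh (S.filter (fun x => bits x = b))
      (chainCode z0 cs fs vs) hinj'
      (fun x => ((chainWeight z0 cs fs vs x : ℕ) : ℝ))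
      (fun x _ => le_of_eq (by rw [l1_chainCode]))
    rwa [hcard] at hres
  calc ∑ x ∈ S, Real.exp (-(α * δ₀ * dist x))
      ≤ ∑ x ∈ S, Real.exp (-((1 / 2) * α * δ₀ * (RM * ((m - 1 : ℕ) : ℝ)))) *
          Real.exp (-((α / 2) * δ₀ * ((chainWeight z0 cs fs vs x : ℕ) : ℝ))) :=
        Finset.sum_le_sum key
    _ = Real.exp (-((1 / 2) * α * δ₀ * (RM * ((m - 1 : ℕ) : ℝ)))) *
          ∑ x ∈ S, Real.exp (-((α / 2) * δ₀ * ((chainWeight z0 cs fs vs x : ℕ) : ℝ))) := by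
        rw [Finset.mul_sum]
    _ = Real.exp (-((1 / 2) * α * δ₀ * (RM * ((m - 1 : ℕ) : ℝ)))) *
          ∑ b : B, ∑ x ∈ S.filter (fun x => bits x = b),
            Real.exp (-((α / 2) * δ₀ * ((chainWeight z0 cs fs vs x : ℕ) : ℝ))) := by
        rw [Finset.sum_fiberwise]
    _ ≤ Real.exp (-((1 / 2) * α * δ₀ * (RM * ((m - 1 : ℕ) : ℝ)))) *
          ∑ _b : B, B6.c0 δ₀ (α / 2) ^ (d * (3 * m + 1)) :=
        mul_le_mul_of_nonneg_left (Finset.sum_le_sum fun b _ => hfiber b) (Real.exp_nonneg _)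
    _ = Real.exp (-((1 / 2) * α * δ₀ * (RM * ((m - 1 : ℕ) : ℝ)))) * (Fintype.card B : ℝ) *
          B6.c0 δ₀ (α / 2) ^ (d * (3 * m + 1)) := by
        rw [Finset.sum_const, Finset.card_univ, nsmul_eq_mul]
        ring

/-! ## 4. The m-floor: the printed lower limit of the m-sum -/

/-- A ±1-step walk moves at most n in n steps. [folklore] -/
theorem abs_walk_le (js : ℕ → ℤ) : ∀ n : ℕ, (∀ l, l < n → |js (l + 1) - js l| ≤ 1) →
    |js n - js 0| ≤ n := by
  intro n
  induction n with
  | zero => simp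
  | succ n ih =>
      intro hs
      have h1 : |js n - js 0| ≤ n := ih fun l hl => hs l (by omega)
      have h2 : |js (n + 1) - js n| ≤ 1 := hs n (by omega)
      have h3 : |js (n + 1) - js 0| ≤ |js (n + 1) - js n| + |js n - js 0| := by
        have h := abs_add_le (js (n + 1) - js n) (js n - js 0)
        have he : js (n + 1) - js n + (js n - js 0) = js (n + 1) - js 0 := by ring
        rwa [he] at h
      calc |js (n + 1) - js 0| ≤ 1 + (n : ℤ) := by linarith
        _ = ((n + 1 : ℕ) : ℤ) := by push_cast; ring

/-- **m-floor** (the lower limit `m = max{|j−j′|−1, 0}` of the m-sum in (2.58), not argued in print): the surface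
indices step by at most one, the first is adjacent to the region of `y`, the last to the region of `y′`. [cite:
Balaban1984PropagatorsII, (2.47) p.231 + (2.58) p.233] -/
theorem mFloor {m : ℕ} (j j' : ℤ) (js : ℕ → ℤ)
    (hstep : ∀ l, l + 1 < m → |js (l + 1) - js l| ≤ 1)
    (hfirst : 0 < m → |js 0 - j| ≤ 1)
    (hlast : 0 < m → |js (m - 1) - j'| ≤ 1)
    (hzero : m = 0 → |j - j'| ≤ 1) :
    B6Lemma21Arith.m0 (j - j') ≤ m := by
  have hgoal : |j - j'| ≤ (m : ℤ) + 1 := by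
    rcases Nat.eq_zero_or_pos m with h0 | hpos
    · have h := hzero h0
      subst h0
      calc |j - j'| ≤ 1 := h
        _ ≤ ((0 : ℕ) : ℤ) + 1 := by norm_num
    · have h1 := abs_le.1 (hfirst hpos)
      have h2 := abs_le.1 (hlast hpos)
      have h3 := abs_le.1 (abs_walk_le js (m - 1) fun l hl => hstep l (by omega))
      have hm1 : ((m - 1 : ℕ) : ℤ) = (m : ℤ) - 1 := by omega
      rw [hm1] at h3
      rw [abs_le]
      constructor <;> linarith [h1.1, h1.2, h2.1, h2.2, h3.1, h3.2]
  have h0 : 0 ≤ |j - j'| := abs_nonneg _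
  unfold B6Lemma21Arith.m0
  omega

/-! ## 5. Branched arithmetic: the `2^{(m−1)⁺}` multiplicity is absorbed by the SAME (2.59) -/

/-- **Branched inner m-sum** (G-A16-1 repair): with the `2^{(m−1)⁺}` index-sequence multiplicity the geometric ratio
is `q′ = 2e^{−A}c³ ≤ 2e^{−2}c^{−1} ≤ 2e^{−2} < e^{−1}` (`2 < e`), and the bound of
`B6Lemma21TwoScale.inner_sum_twoScale_le` holds VERBATIM. [cite: Balaban1984PropagatorsII, (2.58)–(2.59) p.233;
corrected] -/
theorem inner_sum_branched_le {A c : ℝ} (hc : 1 ≤ c) (hA : 4 * Real.log c + 2 < A) (m₀ : ℕ) :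
    ∑' m : ℕ, (2 : ℝ) ^ (m₀ + m - 1 : ℕ) * Real.exp (-(A * ((m₀ + m - 1 : ℕ) : ℝ)))
        * c ^ (3 * (m₀ + m) + 1)
      ≤ (if m₀ = 0 then c else 0)
        + c ^ 4 * Real.exp (-((m₀ - 1 : ℕ) : ℝ)) / (1 - Real.exp (-1)) := by
  have hcpos : 0 < c := by linarith
  have hlogc : 0 ≤ Real.log c := Real.log_nonneg hc
  set q : ℝ := 2 * (Real.exp (-A) * c ^ 3) with hq
  have hqpos : 0 < q := by positivity
  have hq1 : q ≤ Real.exp (-1) := by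
    have hlogq : Real.log q = Real.log 2 + (-A + 3 * Real.log c) := by
      rw [hq, Real.log_mul two_ne_zero (by positivity),
        Real.log_mul (Real.exp_pos _).ne' (by positivity), Real.log_exp, Real.log_pow]
      push_cast
      ring
    have hlog2 : Real.log 2 < 0.6931471808 := Real.log_two_lt_d9
    calc q = Real.exp (Real.log q) := (Real.exp_log hqpos).symm
      _ ≤ Real.exp (-1) := by
          apply Real.exp_le_exp.2
          rw [hlogq]
          linarith
  have he1 : Real.exp (-1) < 1 := by
    rw [Real.exp_lt_one_iff]
    norm_num
  have hqlt : q < 1 := lt_of_le_of_lt hq1 he1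
  have hden : 0 < 1 - Real.exp (-1) := by linarith
  have hden' : (1 - q)⁻¹ ≤ (1 - Real.exp (-1))⁻¹ := inv_anti₀ (by linarith) (by linarith)
  have h1q : 0 ≤ (1 - q)⁻¹ := inv_nonneg.2 (by linarith)
  have hterm : ∀ n : ℕ, 1 ≤ n →
      (2 : ℝ) ^ (n - 1 : ℕ) * Real.exp (-(A * ((n - 1 : ℕ) : ℝ))) * c ^ (3 * n + 1)
        = c ^ 4 * q ^ (n - 1) := by
    intro n hn
    obtain ⟨k, rfl⟩ : ∃ k, n = k + 1 := ⟨n - 1, by omega⟩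
    have h1 : Real.exp (-(A * ((k + 1 - 1 : ℕ) : ℝ))) = Real.exp (-A) ^ k := by
      rw [← Real.exp_nat_mul]
      congr 1
      simp only [Nat.add_sub_cancel]
      ring
    rw [h1, hq, Nat.add_sub_cancel, mul_pow, mul_pow, ← pow_mul]
    have h34 : 3 * (k + 1) + 1 = 3 * k + 4 := by ring
    rw [h34, pow_add]
    ring
  rcases Nat.eq_zero_or_pos m₀ with h0 | hpos
  · subst h0
    simp only [zero_add, Nat.zero_sub, if_true, Nat.cast_zero, neg_zero, Real.exp_zero, mul_one]
    have hf : (fun m : ℕ => (2 : ℝ) ^ (m - 1 : ℕ) * Real.exp (-(A * ((m - 1 : ℕ) : ℝ)))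
          * c ^ (3 * m + 1))
        = fun m : ℕ => if m = 0 then c else c ^ 4 * q ^ (m - 1) := by
      funext m
      rcases Nat.eq_zero_or_pos m with hm | hm
      · subst hm
        simp
      · rw [if_neg (by omega), hterm m hm]
    rw [hf]
    have hshift : (fun m : ℕ => if m + 1 = 0 then c else c ^ 4 * q ^ (m + 1 - 1))
        = fun m : ℕ => c ^ 4 * q ^ m := by
      funext m
      simp
    have hsum_shift : Summable fun m : ℕ => if m + 1 = 0 then c else c ^ 4 * q ^ (m + 1 - 1) := by
      rw [hshift]
      exact (summable_geometric_of_lt_one hqpos.le hqlt).mul_left _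
    have hsum : Summable fun m : ℕ => if m = 0 then c else c ^ 4 * q ^ (m - 1) :=
      (summable_nat_add_iff 1).1 hsum_shift
    rw [hsum.tsum_eq_zero_add]
    simp only [if_true, hshift]
    rw [tsum_mul_left, tsum_geometric_of_lt_one hqpos.le hqlt]
    have hfin : c ^ 4 * (1 - q)⁻¹ ≤ c ^ 4 / (1 - Real.exp (-1)) := by
      rw [div_eq_mul_inv]
      exact mul_le_mul_of_nonneg_left hden' (by positivity)
    linarith
  · rw [if_neg (by omega)]
    have hf : (fun m : ℕ => (2 : ℝ) ^ (m₀ + m - 1 : ℕ) * Real.exp (-(A * ((m₀ + m - 1 : ℕ) : ℝ)))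
          * c ^ (3 * (m₀ + m) + 1))
        = fun m : ℕ => c ^ 4 * q ^ (m₀ - 1) * q ^ m := by
      funext m
      rw [hterm (m₀ + m) (by omega)]
      have hsplit : m₀ + m - 1 = (m₀ - 1) + m := by omega
      rw [hsplit, pow_add, mul_assoc]
    rw [hf, tsum_mul_left, tsum_geometric_of_lt_one hqpos.le hqlt]
    have hqm : q ^ (m₀ - 1) ≤ Real.exp (-((m₀ - 1 : ℕ) : ℝ)) := by
      calc q ^ (m₀ - 1) ≤ Real.exp (-1) ^ (m₀ - 1) := pow_le_pow_left₀ hqpos.le hq1 _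
        _ = Real.exp (-((m₀ - 1 : ℕ) : ℝ)) := by
            rw [← Real.exp_nat_mul]
            congr 1
            ring
    have hfin : c ^ 4 * q ^ (m₀ - 1) * (1 - q)⁻¹
        ≤ c ^ 4 * Real.exp (-((m₀ - 1 : ℕ) : ℝ)) * (1 - Real.exp (-1))⁻¹ := by
      apply mul_le_mul (mul_le_mul_of_nonneg_left hqm (by positivity)) hden' h1q (by positivity)
    rw [div_eq_mul_inv]
    linarith

/-- Summability of the branched inner m-sum (needed for the finite-sum comparisons of the assembly). [folklore] -/
theorem summable_branched_inner {A c : ℝ} (hc : 1 ≤ c) (hA : 4 * Real.log c + 2 < A) (m₀ : ℕ) :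
    Summable (fun m : ℕ => (2 : ℝ) ^ (m₀ + m - 1 : ℕ) * Real.exp (-(A * ((m₀ + m - 1 : ℕ) : ℝ)))
      * c ^ (3 * (m₀ + m) + 1)) := by
  have hcpos : 0 < c := by linarith
  have hlogc : 0 ≤ Real.log c := Real.log_nonneg hc
  set q : ℝ := 2 * (Real.exp (-A) * c ^ 3) with hq
  have hqpos : 0 < q := by positivity
  have hq1 : q ≤ Real.exp (-1) := by
    have hlogq : Real.log q = Real.log 2 + (-A + 3 * Real.log c) := by
      rw [hq, Real.log_mul two_ne_zero (by positivity),
        Real.log_mul (Real.exp_pos _).ne' (by positivity), Real.log_exp, Real.log_pow]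
      push_cast
      ring
    have hlog2 : Real.log 2 < 0.6931471808 := Real.log_two_lt_d9
    calc q = Real.exp (Real.log q) := (Real.exp_log hqpos).symm
      _ ≤ Real.exp (-1) := by
          apply Real.exp_le_exp.2
          rw [hlogq]
          linarith
  have he1 : Real.exp (-1) < 1 := by
    rw [Real.exp_lt_one_iff]
    norm_num
  have hqlt : q < 1 := lt_of_le_of_lt hq1 he1
  have hterm : ∀ n : ℕ, 1 ≤ n →
      (2 : ℝ) ^ (n - 1 : ℕ) * Real.exp (-(A * ((n - 1 : ℕ) : ℝ))) * c ^ (3 * n + 1)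
        = c ^ 4 * q ^ (n - 1) := by
    intro n hn
    obtain ⟨k, rfl⟩ : ∃ k, n = k + 1 := ⟨n - 1, by omega⟩
    have h1 : Real.exp (-(A * ((k + 1 - 1 : ℕ) : ℝ))) = Real.exp (-A) ^ k := by
      rw [← Real.exp_nat_mul]
      congr 1
      simp only [Nat.add_sub_cancel]
      ring
    rw [h1, hq, Nat.add_sub_cancel, mul_pow, mul_pow, ← pow_mul]
    have h34 : 3 * (k + 1) + 1 = 3 * k + 4 := by ring
    rw [h34, pow_add]
    ring
  rcases Nat.eq_zero_or_pos m₀ with h0 | hpos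
  · subst h0
    have hf : (fun m : ℕ => (2 : ℝ) ^ (0 + m - 1 : ℕ) * Real.exp (-(A * ((0 + m - 1 : ℕ) : ℝ)))
          * c ^ (3 * (0 + m) + 1))
        = fun m : ℕ => if m = 0 then c else c ^ 4 * q ^ (m - 1) := by
      funext m
      rcases Nat.eq_zero_or_pos m with hm | hm
      · subst hm
        simp
      · rw [Nat.zero_add, if_neg (by omega), hterm m hm]
    rw [hf]
    have hshift : (fun m : ℕ => if m + 1 = 0 then c else c ^ 4 * q ^ (m + 1 - 1))
        = fun m : ℕ => c ^ 4 * q ^ m := by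
      funext m
      simp
    have hsum_shift : Summable fun m : ℕ => if m + 1 = 0 then c else c ^ 4 * q ^ (m + 1 - 1) := by
      rw [hshift]
      exact (summable_geometric_of_lt_one hqpos.le hqlt).mul_left _
    exact (summable_nat_add_iff 1).1 hsum_shift
  · have hf : (fun m : ℕ => (2 : ℝ) ^ (m₀ + m - 1 : ℕ) * Real.exp (-(A * ((m₀ + m - 1 : ℕ) : ℝ)))
          * c ^ (3 * (m₀ + m) + 1))
        = fun m : ℕ => c ^ 4 * q ^ (m₀ - 1) * q ^ m := by
      funext m
      rw [hterm (m₀ + m) (by omega)]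
      have hsplit : m₀ + m - 1 = (m₀ - 1) + m := by omega
      rw [hsplit, pow_add, mul_assoc]
    rw [hf]
    exact (summable_geometric_of_lt_one hqpos.le hqlt).mul_left _

/-- **Branched (2.58″) ⇒ (2.61″), kernel engine + summability.** Under the SAME (2.59), the branched double sum is
still ≤ `c1TwoScale d δ₀ α = 13c₀(½α)^{4d}` — the `2^{(m−1)⁺}` multiplicity costs NOTHING in the constant.
[cite: Balaban1984PropagatorsII, (2.58)–(2.61) pp.233–234; corrected] -/
theorem ineq258Branched_summable_and_le {d : ℕ} {δ₀ α R M : ℝ} (hα : 0 < α) (hδ : 0 < δ₀)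
    (h259 : B6.Cond259 d δ₀ α R M) (j : ℤ) :
    Summable (fun j' : ℤ => ∑' m : ℕ,
        (2 : ℝ) ^ (B6Lemma21Arith.m0 (j - j') + m - 1 : ℕ)
          * Real.exp (-((1 / 2) * α * δ₀ * R * M * ((B6Lemma21Arith.m0 (j - j') + m - 1 : ℕ) : ℝ)))
          * (B6.c0 δ₀ (α / 2) ^ d) ^ (3 * (B6Lemma21Arith.m0 (j - j') + m) + 1))
    ∧ ∑' j' : ℤ, ∑' m : ℕ,
        (2 : ℝ) ^ (B6Lemma21Arith.m0 (j - j') + m - 1 : ℕ)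
          * Real.exp (-((1 / 2) * α * δ₀ * R * M * ((B6Lemma21Arith.m0 (j - j') + m - 1 : ℕ) : ℝ)))
          * (B6.c0 δ₀ (α / 2) ^ d) ^ (3 * (B6Lemma21Arith.m0 (j - j') + m) + 1)
      ≤ B6Lemma21TwoScale.c1TwoScale d δ₀ α := by
  have hc0 : 1 ≤ B6.c0 δ₀ (α / 2) := B6Lemma21Arith.one_le_c0 (by positivity)
  have hc : 1 ≤ B6.c0 δ₀ (α / 2) ^ d := one_le_pow₀ hc0
  set c := B6.c0 δ₀ (α / 2) ^ d with hcdef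
  have hA := (B6Lemma21Arith.cond259_iff_A (d := d) (R := R) (M := M)).1 h259
  rw [← hcdef] at hA
  set A := (1 / 2) * α * δ₀ * R * M
  have hr : Real.exp (-1) < 1 := by
    rw [Real.exp_lt_one_iff]
    norm_num
  have hden : 0 < 1 - Real.exp (-1) := by linarith
  have hm0_sub : ∀ z : ℤ, B6Lemma21Arith.m0 z - 1 = (|z| - 2).toNat := by
    intro z
    unfold B6Lemma21Arith.m0
    omega
  have hm0_zero : ∀ z : ℤ, (B6Lemma21Arith.m0 z = 0 ↔ |z| ≤ 1) := by
    intro z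
    unfold B6Lemma21Arith.m0
    omega
  let K : ℝ := c ^ 4 / (1 - Real.exp (-1))
  let g : ℤ → ℝ := fun z => (if |z| ≤ 1 then c else 0)
    + K * Real.exp (-(((|z| - 2).toNat : ℕ) : ℝ))
  have hinner : ∀ j' : ℤ,
      ∑' m : ℕ, (2 : ℝ) ^ (B6Lemma21Arith.m0 (j - j') + m - 1 : ℕ)
          * Real.exp (-(A * ((B6Lemma21Arith.m0 (j - j') + m - 1 : ℕ) : ℝ)))
          * c ^ (3 * (B6Lemma21Arith.m0 (j - j') + m) + 1)
        ≤ g (j - j') := by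
    intro j'
    calc _ ≤ (if B6Lemma21Arith.m0 (j - j') = 0 then c else 0)
          + c ^ 4 * Real.exp (-((B6Lemma21Arith.m0 (j - j') - 1 : ℕ) : ℝ)) / (1 - Real.exp (-1)) :=
          inner_sum_branched_le hc hA _
      _ = g (j - j') := by
          simp only [g, K, hm0_sub, hm0_zero]
          ring
  have hnn : ∀ j' : ℤ, 0 ≤ ∑' m : ℕ,
      (2 : ℝ) ^ (B6Lemma21Arith.m0 (j - j') + m - 1 : ℕ)
        * Real.exp (-(A * ((B6Lemma21Arith.m0 (j - j') + m - 1 : ℕ) : ℝ)))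
        * c ^ (3 * (B6Lemma21Arith.m0 (j - j') + m) + 1) :=
    fun j' => tsum_nonneg fun m => by positivity
  have hind_sum : Summable fun z : ℤ => (if |z| ≤ 1 then c else (0 : ℝ)) := by
    apply summable_of_ne_finset_zero (s := ({-1, 0, 1} : Finset ℤ))
    intro z hz
    rw [if_neg]
    intro hzz
    apply hz
    simp only [Finset.mem_insert, Finset.mem_singleton]
    have h' := abs_le.1 hzz
    omega
  have hind_val : ∑' z : ℤ, (if |z| ≤ 1 then c else (0 : ℝ)) = 3 * c := by
    rw [tsum_eq_sum (s := ({-1, 0, 1} : Finset ℤ))]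
    · rw [Finset.sum_insert (by decide), Finset.sum_insert (by decide), Finset.sum_singleton]
      simp
      ring
    · intro z hz
      rw [if_neg]
      intro hzz
      apply hz
      simp only [Finset.mem_insert, Finset.mem_singleton]
      have h' := abs_le.1 hzz
      omega
  have hexp_sum : Summable fun z : ℤ => Real.exp (-(((|z| - 2).toNat : ℕ) : ℝ)) := by
    apply Summable.of_nonneg_of_le (fun z => (Real.exp_pos _).le)
      (fun z => ?_) (B6Lemma21Arith.summable_int_exp_neg_abs.mul_left (Real.exp 2))
    rw [← Real.exp_add, Real.exp_le_exp]
    have hcast : ((|z| - 2 : ℤ) : ℝ) ≤ (((|z| - 2).toNat : ℕ) : ℝ) := by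
      exact_mod_cast Int.self_le_toNat (|z| - 2)
    push_cast at hcast
    linarith
  have hmaj : Summable g := hind_sum.add (hexp_sum.mul_left K)
  have hmaj' : Summable fun j' : ℤ => g (j - j') :=
    ((Equiv.subLeft j).summable_iff (f := g)).2 hmaj
  have hsum := Summable.of_nonneg_of_le hnn hinner hmaj'
  refine ⟨hsum, ?_⟩
  calc _ ≤ ∑' j' : ℤ, g (j - j') := hsum.tsum_le_tsum hinner hmaj'
    _ = ∑' z : ℤ, g z := (Equiv.subLeft j).tsum_eq g
    _ = 3 * c + K * (3 + 2 * (1 - Real.exp (-1))⁻¹) := by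
        simp only [g]
        rw [Summable.tsum_add hind_sum (hexp_sum.mul_left K), hind_val, tsum_mul_left,
          B6Lemma21Arith.tsum_int_exp_neg_abs_sub_two]
    _ = c * 3 + c ^ 4 * ((3 + 2 * (1 - Real.exp (-1))⁻¹) * (1 - Real.exp (-1))⁻¹) := by
        simp only [K]
        ring
    _ ≤ c ^ 4 * 3 + c ^ 4 * ((3 + 2 * (1 - Real.exp (-1))⁻¹) * (1 - Real.exp (-1))⁻¹) := by
        have hc4 : c ≤ c ^ 4 := by
          calc c = c ^ 1 := (pow_one c).symm
            _ ≤ c ^ 4 := pow_le_pow_right₀ hc (by norm_num)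
        nlinarith
    _ = c ^ 4 * (3 + (3 + 2 * (1 - Real.exp (-1))⁻¹) * (1 - Real.exp (-1))⁻¹) := by ring
    _ ≤ c ^ 4 * 13 :=
        mul_le_mul_of_nonneg_left B6Lemma21Arith.repaired_constant_le_thirteen (by positivity)
    _ = B6Lemma21TwoScale.c1TwoScale d δ₀ α := by
        rw [B6Lemma21TwoScale.c1TwoScale, hcdef, ← pow_mul]
        ring

/-! ## 6. Assembly: (2.61″) from the typed decomposition data (2.47)/(2.48)/(2.57) -/

/-- **The shrunken leaf**: typed decomposition data for the minimising contours, relative to a base point `y`. Each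
field is a direct transcription of a printed sentence of pp. 231–233 (quoted in the module header): `m` = number of
surfaces crossed, `js` = their indices ((2.47): steps of (at most) one, first adjacent to the region of `y`, last to
that of `y′`), the three families of legs with (2.48) (total bond count ≤ d(y,y′)) and (2.57) for the m − 1 middle
crossing legs, and the sequential-reconstruction property (`hinj`): two sites of equal scale and crossing number
with equal leg codes and equal surface-step signs coincide — the surfaces being disjoint, the intermediate points
are recovered leg by leg from `y`, the codes, and the branch signs. NO analytic content remains here. [cite:
Balaban1984PropagatorsII, (2.46)–(2.48) pp.231–232, (2.57) p.233] -/
structure Decomp247 (g : B6.Geometry) (d : ℕ) (y : g.Site) where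
  m : g.Site → ℕ
  js : g.Site → ℕ → ℤ
  leg0 : g.Site → List (Step d)
  legS : g.Site → ℕ → List (Step d)
  legX : g.Site → ℕ → List (Step d)
  hstep : ∀ y' l, l + 1 < m y' → |js y' (l + 1) - js y' l| ≤ 1
  hfirst : ∀ y', 0 < m y' → |js y' 0 - (g.scale y : ℤ)| ≤ 1
  hlast : ∀ y', 0 < m y' → |js y' (m y' - 1) - (g.scale y' : ℤ)| ≤ 1
  hzero : ∀ y', m y' = 0 → |(g.scale y : ℤ) - (g.scale y' : ℤ)| ≤ 1
  hsep : ∀ y', g.R * g.M * ((m y' - 1 : ℕ) : ℝ) ≤ g.dist y y'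
  hwt : ∀ y', (((leg0 y').length + (∑ l ∈ Finset.range (m y'), (legS y' l).length)
      + ∑ l ∈ Finset.range (m y'), (legX y' l).length : ℕ) : ℝ) ≤ g.dist y y'
  hinj : ∀ y₁ y₂ : g.Site, g.scale y₁ = g.scale y₂ → m y₁ = m y₂ →
    pathV (leg0 y₁) = pathV (leg0 y₂) →
    (∀ l, l < m y₁ → pathC (legS y₁ l) = pathC (legS y₂ l)) →
    (∀ l, l < m y₁ → pathF (legS y₁ l) = pathF (legS y₂ l)) →
    (∀ l, l < m y₁ → pathV (legX y₁ l) = pathV (legX y₂ l)) →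
    (∀ l, l + 1 < m y₁ → (js y₁ (l + 1) - js y₁ l ≤ 0 ↔ js y₂ (l + 1) - js y₂ l ≤ 0)) →
    y₁ = y₂

/-- **(2.61″) from the decomposition data** — the geometric bridge, kernel-checked: partition the sites by
`(scale, m)`, apply the chain theorem per group with the `2^{(m−1)⁺}` branch patterns, the m-floor, and the
branched arithmetic; the constant is `c1TwoScale d δ₀ α = 13c₀(½α)^{4d}`, UNCHANGED from G-A13-1. [cite:
Balaban1984PropagatorsII, (2.54)–(2.61) pp.232–234; corrected] -/
theorem ineq261T_of_decomp {g : B6.Geometry} {d : ℕ} {δ₀ α : ℝ} (hα : 0 < α) (hδ : 0 < δ₀)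
    (h259 : B6.Cond259 d δ₀ α g.R g.M)
    (D : ∀ y : g.Site, Decomp247 g d y) :
    B6Lemma21Repaired.Ineq261With (B6Lemma21TwoScale.c1TwoScale d δ₀ α) g δ₀ α := by
  classical
  intro y
  have had : 0 < α * δ₀ := mul_pos hα hδ
  have hc0 : 1 ≤ B6.c0 δ₀ (α / 2) := B6Lemma21Arith.one_le_c0 (by positivity)
  set c := B6.c0 δ₀ (α / 2) ^ d with hcdef
  have hc : 1 ≤ c := by
    rw [hcdef]
    exact one_le_pow₀ hc0
  have hc0' : (0 : ℝ) ≤ c := le_trans zero_le_one hc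
  have hA := (B6Lemma21Arith.cond259_iff_A (d := d) (R := g.R) (M := g.M)).1 h259
  rw [← hcdef] at hA
  set A := (1 / 2) * α * δ₀ * g.R * g.M with hAdef
  set j : ℤ := (g.scale y : ℤ) with hjdef
  obtain ⟨houter, hle⟩ := ineq258Branched_summable_and_le (d := d) hα hδ h259 j
  rw [← hcdef, ← hAdef] at houter hle
  set T : ℤ → ℕ → ℝ := fun j' mm =>
    (2 : ℝ) ^ (B6Lemma21Arith.m0 (j - j') + mm - 1 : ℕ)
      * Real.exp (-(A * ((B6Lemma21Arith.m0 (j - j') + mm - 1 : ℕ) : ℝ)))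
      * c ^ (3 * (B6Lemma21Arith.m0 (j - j') + mm) + 1) with hTdef
  set bound : ℤ → ℕ → ℝ := fun _j' mv =>
    (2 : ℝ) ^ (mv - 1 : ℕ) * Real.exp (-(A * ((mv - 1 : ℕ) : ℝ))) * c ^ (3 * mv + 1) with hbdef
  have hTnn : ∀ (j' : ℤ) (mrel : ℕ), (0 : ℝ) ≤ (2 : ℝ) ^ (B6Lemma21Arith.m0 (j - j') + mrel - 1 : ℕ)
      * Real.exp (-(A * ((B6Lemma21Arith.m0 (j - j') + mrel - 1 : ℕ) : ℝ)))
      * c ^ (3 * (B6Lemma21Arith.m0 (j - j') + mrel) + 1) := by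
    intro j' mrel
    have h2n : (0 : ℝ) ≤ (2 : ℝ) ^ (B6Lemma21Arith.m0 (j - j') + mrel - 1 : ℕ) := by positivity
    exact mul_nonneg (mul_nonneg h2n (Real.exp_nonneg _)) (pow_nonneg hc0' _)
  have hTb : ∀ (j' : ℤ) (mrel : ℕ), T j' mrel = bound j' (B6Lemma21Arith.m0 (j - j') + mrel) := by
    intro j' mrel
    simp only [hTdef, hbdef]
  set φ : g.Site → ℕ × ℕ := fun y' => (g.scale y', (D y).m y') with hφdef
  set P : Finset (ℕ × ℕ) := Finset.image φ Finset.univ with hPdef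
  -- STEP 1: per-fiber bound via the chain theorem
  have hfiber : ∀ p ∈ P, ∑ y' ∈ Finset.univ.filter (fun y' => φ y' = p),
      Real.exp (-(α * δ₀ * g.dist y y')) ≤ bound (p.1 : ℤ) p.2 := by
    intro p hp
    have hinjp : Set.InjOn (fun y' =>
        ((fun l : Fin (p.2 - 1) =>
            decide ((D y).js y' ((l : ℕ) + 1) - (D y).js y' (l : ℕ) ≤ 0)),
          pathV ((D y).leg0 y'),
          (fun l : Fin p.2 => pathC ((D y).legS y' (l : ℕ))),
          (fun l : Fin p.2 => pathF ((D y).legS y' (l : ℕ))),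
          (fun l : Fin p.2 => pathV ((D y).legX y' (l : ℕ)))))
        ↑(Finset.univ.filter (fun y' => φ y' = p)) := by
      intro y₁ hy₁ y₂ hy₂ heq
      have hp₁ : φ y₁ = p := (Finset.mem_filter.1 hy₁).2
      have hp₂ : φ y₂ = p := (Finset.mem_filter.1 hy₂).2
      simp only [hφdef] at hp₁ hp₂
      have hsc : g.scale y₁ = g.scale y₂ := congrArg Prod.fst (hp₁.trans hp₂.symm)
      have hm12 : (D y).m y₁ = (D y).m y₂ := congrArg Prod.snd (hp₁.trans hp₂.symm)
      have hm₁ : (D y).m y₁ = p.2 := congrArg Prod.snd hp₁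
      simp only [Prod.mk.injEq] at heq
      obtain ⟨hbits, hz0, hcs, hfs, hvs⟩ := heq
      refine (D y).hinj y₁ y₂ hsc hm12 hz0 ?_ ?_ ?_ ?_
      · intro l hl
        exact congrFun hcs ⟨l, by omega⟩
      · intro l hl
        exact congrFun hfs ⟨l, by omega⟩
      · intro l hl
        exact congrFun hvs ⟨l, by omega⟩
      · intro l hl
        have hlt : l < p.2 - 1 := by omega
        have hb := congrFun hbits ⟨l, hlt⟩
        simpa using hb
    have hsepp : ∀ y' ∈ Finset.univ.filter (fun y' => φ y' = p),
        (g.R * g.M) * ((p.2 - 1 : ℕ) : ℝ) ≤ g.dist y y' := by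
      intro y' hy'
      have hp' : φ y' = p := (Finset.mem_filter.1 hy').2
      simp only [hφdef] at hp'
      have hmv' : (D y).m y' = p.2 := congrArg Prod.snd hp'
      have hs := (D y).hsep y'
      rwa [hmv'] at hs
    have hwtp : ∀ y' ∈ Finset.univ.filter (fun y' => φ y' = p),
        ((chainWeight (fun y' => pathV ((D y).leg0 y'))
          (fun y' => fun l : Fin p.2 => pathC ((D y).legS y' (l : ℕ)))
          (fun y' => fun l : Fin p.2 => pathF ((D y).legS y' (l : ℕ)))
          (fun y' => fun l : Fin p.2 => pathV ((D y).legX y' (l : ℕ))) y' : ℕ) : ℝ)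
          ≤ g.dist y y' := by
      intro y' hy'
      have hp' : φ y' = p := (Finset.mem_filter.1 hy').2
      simp only [hφdef] at hp'
      have hmv' : (D y).m y' = p.2 := congrArg Prod.snd hp'
      have h0 := path_l1_bound_V ((D y).leg0 y')
      have hS : (∑ l : Fin p.2, (l1 (pathC ((D y).legS y' (l : ℕ)))
            + l1 (pathF ((D y).legS y' (l : ℕ)))))
          ≤ ∑ l ∈ Finset.range p.2, ((D y).legS y' l).length := by
        rw [← Fin.sum_univ_eq_sum_range (fun l => (((D y).legS y' l).length)) p.2]
        exact Finset.sum_le_sum fun l _ => path_l1_bound _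
      have hX : (∑ l : Fin p.2, l1 (pathV ((D y).legX y' (l : ℕ))))
          ≤ ∑ l ∈ Finset.range p.2, ((D y).legX y' l).length := by
        rw [← Fin.sum_univ_eq_sum_range (fun l => (((D y).legX y' l).length)) p.2]
        exact Finset.sum_le_sum fun l _ => path_l1_bound_V _
      have htot := (D y).hwt y'
      rw [hmv'] at htot
      have hcw : chainWeight (fun y' => pathV ((D y).leg0 y'))
          (fun y' => fun l : Fin p.2 => pathC ((D y).legS y' (l : ℕ)))
          (fun y' => fun l : Fin p.2 => pathF ((D y).legS y' (l : ℕ)))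
          (fun y' => fun l : Fin p.2 => pathV ((D y).legX y' (l : ℕ))) y'
          ≤ ((D y).leg0 y').length + (∑ l ∈ Finset.range p.2, ((D y).legS y' l).length)
            + ∑ l ∈ Finset.range p.2, ((D y).legX y' l).length := by
        simp only [chainWeight]
        omega
      calc ((chainWeight (fun y' => pathV ((D y).leg0 y'))
            (fun y' => fun l : Fin p.2 => pathC ((D y).legS y' (l : ℕ)))
            (fun y' => fun l : Fin p.2 => pathF ((D y).legS y' (l : ℕ)))
            (fun y' => fun l : Fin p.2 => pathV ((D y).legX y' (l : ℕ))) y' : ℕ) : ℝ)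
          ≤ ((((D y).leg0 y').length + (∑ l ∈ Finset.range p.2, ((D y).legS y' l).length)
            + ∑ l ∈ Finset.range p.2, ((D y).legX y' l).length : ℕ) : ℝ) := by
            exact_mod_cast hcw
        _ ≤ g.dist y y' := htot
    calc ∑ y' ∈ Finset.univ.filter (fun y' => φ y' = p), Real.exp (-(α * δ₀ * g.dist y y'))
        ≤ Real.exp (-((1 / 2) * α * δ₀ * ((g.R * g.M) * ((p.2 - 1 : ℕ) : ℝ))))
            * (Fintype.card (Fin (p.2 - 1) → Bool) : ℝ)
            * B6.c0 δ₀ (α / 2) ^ (d * (3 * p.2 + 1)) :=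
          chain_group_sum (RM := g.R * g.M) had (Finset.univ.filter (fun y' => φ y' = p))
            (Fin (p.2 - 1) → Bool)
            (fun y' => fun l : Fin (p.2 - 1) =>
              decide ((D y).js y' ((l : ℕ) + 1) - (D y).js y' (l : ℕ) ≤ 0))
            (fun y' => pathV ((D y).leg0 y'))
            (fun y' => fun l : Fin p.2 => pathC ((D y).legS y' (l : ℕ)))
            (fun y' => fun l : Fin p.2 => pathF ((D y).legS y' (l : ℕ)))
            (fun y' => fun l : Fin p.2 => pathV ((D y).legX y' (l : ℕ)))
            hinjp (fun y' => g.dist y y') hsepp hwtp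
      _ = bound (p.1 : ℤ) p.2 := by
          simp only [hbdef]
          have hexp : Real.exp (-((1 / 2) * α * δ₀ * ((g.R * g.M) * ((p.2 - 1 : ℕ) : ℝ))))
              = Real.exp (-(A * ((p.2 - 1 : ℕ) : ℝ))) :=
            congrArg Real.exp (by rw [hAdef]; ring)
          have hcardb : (Fintype.card (Fin (p.2 - 1) → Bool) : ℝ) = (2 : ℝ) ^ (p.2 - 1 : ℕ) := by
            rw [Fintype.card_fun, Fintype.card_bool, Fintype.card_fin]
            push_cast
            rfl
          have hpow : B6.c0 δ₀ (α / 2) ^ (d * (3 * p.2 + 1)) = c ^ (3 * p.2 + 1) := by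
            rw [hcdef, ← pow_mul]
          rw [hexp, hcardb, hpow]
          ring
  -- STEP 2: the m-floor per realized fiber
  have hfloor : ∀ p ∈ P, B6Lemma21Arith.m0 (j - (p.1 : ℤ)) ≤ p.2 := by
    intro p hp
    rw [hPdef] at hp
    obtain ⟨y', -, hy'⟩ := Finset.mem_image.1 hp
    have h1 : g.scale y' = p.1 := by
      rw [← hy']
    have h2 : (D y).m y' = p.2 := by
      rw [← hy']
    rw [← h1, ← h2]
    refine mFloor j (g.scale y') ((D y).js y') (fun l hl => (D y).hstep y' l hl) ?_ ?_ ?_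
    · intro hm
      have hf := (D y).hfirst y' hm
      rwa [← hjdef] at hf
    · intro hm
      exact (D y).hlast y' hm
    · intro hm
      have hf := (D y).hzero y' hm
      rwa [← hjdef] at hf
  -- STEP 3: sum the fibers, compare with the branched double tsum
  have hinner_cmp : ∀ j'n ∈ Finset.image Prod.fst P,
      ∑ p ∈ P.filter (fun p => p.1 = j'n), bound (p.1 : ℤ) p.2
        ≤ ∑' mrel : ℕ, T (j'n : ℤ) mrel := by
    intro j'n hj'n
    have hmemM : ∀ p ∈ P.filter (fun p => p.1 = j'n),
        B6Lemma21Arith.m0 (j - (j'n : ℤ)) ≤ p.2 := by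
      intro p hp
      have h1 := hfloor p (Finset.mem_filter.1 hp).1
      rwa [(Finset.mem_filter.1 hp).2] at h1
    have hinjsnd : Set.InjOn (Prod.snd : ℕ × ℕ → ℕ) ↑(P.filter (fun p => p.1 = j'n)) := by
      intro p hp q hq hpq
      have hp1 : p.1 = j'n := (Finset.mem_filter.1 hp).2
      have hq1 : q.1 = j'n := (Finset.mem_filter.1 hq).2
      exact Prod.ext (hp1.trans hq1.symm) hpq
    have hmemM' : ∀ mv ∈ (P.filter (fun p => p.1 = j'n)).image Prod.snd,
        B6Lemma21Arith.m0 (j - (j'n : ℤ)) ≤ mv := by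
      intro mv hmv
      obtain ⟨p, hp, hps⟩ := Finset.mem_image.1 hmv
      subst hps
      exact hmemM p hp
    have hinjsub : Set.InjOn (fun mv => mv - B6Lemma21Arith.m0 (j - (j'n : ℤ)))
        ↑((P.filter (fun p => p.1 = j'n)).image Prod.snd) := by
      intro a ha b hb hab
      have ha' := hmemM' a ha
      have hb' := hmemM' b hb
      simp only at hab
      omega
    calc ∑ p ∈ P.filter (fun p => p.1 = j'n), bound (p.1 : ℤ) p.2
        = ∑ p ∈ P.filter (fun p => p.1 = j'n), bound (j'n : ℤ) p.2 :=
          Finset.sum_congr rfl fun p hp => by rw [(Finset.mem_filter.1 hp).2]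
      _ = ∑ mv ∈ (P.filter (fun p => p.1 = j'n)).image Prod.snd, bound (j'n : ℤ) mv :=
          (Finset.sum_image hinjsnd).symm
      _ = ∑ mrel ∈ ((P.filter (fun p => p.1 = j'n)).image Prod.snd).image
            (fun mv => mv - B6Lemma21Arith.m0 (j - (j'n : ℤ))), T (j'n : ℤ) mrel := by
          rw [Finset.sum_image hinjsub]
          refine Finset.sum_congr rfl fun mv hmv => ?_
          have hle' : B6Lemma21Arith.m0 (j - (j'n : ℤ)) ≤ mv := hmemM' mv hmv
          have h2 : B6Lemma21Arith.m0 (j - (j'n : ℤ))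
              + (mv - B6Lemma21Arith.m0 (j - (j'n : ℤ))) = mv := by omega
          have h3 := hTb (j'n : ℤ) (mv - B6Lemma21Arith.m0 (j - (j'n : ℤ)))
          rw [h2] at h3
          exact h3.symm
      _ ≤ ∑' mrel : ℕ, T (j'n : ℤ) mrel := by
          simp only [hTdef]
          exact (summable_branched_inner hc hA _).sum_le_tsum _ (fun mrel _ => hTnn _ _)
  calc ∑ y' : g.Site, Real.exp (-(α * δ₀ * g.dist y y'))
      = ∑ p ∈ P, ∑ y' ∈ Finset.univ.filter (fun y' => φ y' = p),
          Real.exp (-(α * δ₀ * g.dist y y')) := by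
        rw [hPdef]
        exact (Finset.sum_fiberwise_of_maps_to
          (fun y' _ => Finset.mem_image_of_mem φ (Finset.mem_univ y')) _).symm
    _ ≤ ∑ p ∈ P, bound (p.1 : ℤ) p.2 := Finset.sum_le_sum hfiber
    _ = ∑ j'n ∈ Finset.image Prod.fst P, ∑ p ∈ P.filter (fun p => p.1 = j'n),
          bound (p.1 : ℤ) p.2 :=
        (Finset.sum_fiberwise_of_maps_to (fun p hp => Finset.mem_image_of_mem Prod.fst hp) _).symm
    _ ≤ ∑ j'n ∈ Finset.image Prod.fst P, ∑' mrel : ℕ, T (j'n : ℤ) mrel :=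
        Finset.sum_le_sum hinner_cmp
    _ = ∑ z ∈ (Finset.image Prod.fst P).image (fun n : ℕ => (n : ℤ)),
          ∑' mrel : ℕ, T z mrel := by
        have hinjcast : Set.InjOn (fun n : ℕ => (n : ℤ)) ↑(Finset.image Prod.fst P) := by
          intro a _ b _ hab
          simpa using hab
        rw [Finset.sum_image (g := fun n : ℕ => (n : ℤ)) hinjcast]
    _ ≤ ∑' z : ℤ, ∑' mrel : ℕ, T z mrel := by
        simp only [hTdef]
        exact houter.sum_le_tsum _ (fun z _ => tsum_nonneg fun mrel => hTnn z mrel)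
    _ ≤ B6Lemma21TwoScale.c1TwoScale d δ₀ α := by
        simp only [hTdef]
        exact hle

/-- **Lemma 2.1, two-scale constant, from the decomposition data**: the analytic leaf `h261T` of
`B6Lemma21TwoScale.lemma21TwoScale_of_ineq261T` is DISCHARGED — what remains of Lemma 2.1 is (2.60) (already kernel
from the level-gap data) and the EXISTENCE of `Decomp247` for the minimising contours. [cite:
Balaban1984PropagatorsII, Lemma 2.1 p.234; repaired] -/
theorem lemma21TwoScale_of_decomp {I : Type} (d : ℕ) (δ₀ : ℝ) (hδ : 0 < δ₀)
    (geo : I → B6.Geometry)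
    (C : ∀ i, B6Geometry.ContourSystem (geo i)) (N : I → ℕ)
    (hreal : ∀ i, B6Geometry.Realizes (geo i) (C i)) (hconn : ∀ i, (C i).bond.Connected)
    (hgap : ∀ i, B6Geometry.LevelGap (C i).bond (C i).zone (N i))
    (hRM : ∀ i, (geo i).R * (geo i).M ≤ N i)
    (hdecomp : ∀ i, (geo i).Hyp21_22 → ∀ y : (geo i).Site, Decomp247 (geo i) d y) :
    B6Lemma21TwoScale.Lemma21TwoScale d δ₀ geo := by
  apply B6Lemma21TwoScale.lemma21TwoScale_of_ineq261T d δ₀ hδ.le geo C N hreal hconn hgap hRM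
  intro i hH α hα0 hα1 h259
  exact ineq261T_of_decomp hα0 hδ h259 (hdecomp i hH)

end Literature.MathematicalPhysics.QuantumFieldTheory.Balaban1983to89.B6Lemma21Bridge
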